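import Summits.ABC.IUTFork.Conditional.AbcOfSGenuineMChosenDepthRadTriple
import Summits.ABC.IUTFork.Conditional.AbcOfSGenuineKChosenDepthRadRowsReyssat
import HarnessLib

/-!
# Branch C, M line / R-W: the RAD rows of abc-iut-w5-d236's `AbcOfSGenuineKChosenDepthRadRowsReyssat` PORTED TO THE M LINE — M twins closing the R-W numerics lead's M-TWIN-GAP

PROOF-ONLY file (no `def`, no new `Prop`, no instance) of the abc-iut cell (D-0079 R-W numerics crew seat abc-iut-W-num-6, gen 2; row «W:M-RAD-PORT»;
sequel of this seat's `AbcOfSGenuineMChosenDepthRad` / `…Triple`). TAKES NO SIDE on [IUTchIII] Cor. 3.12 or on any author. Every theorem here is the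
M-LINE TWIN of the same-stem K-line theorem of `AbcOfSGenuineKChosenDepthRadRowsReyssat` (abc-iut-w5-d236): SAME abc triple (its `IsABCTriple` lemma BY NAME), SAME pole prime `p`
(entering as a finite place `u` of `ℚ` with `ratChar u = p`), SAME label, SAME Tate-exact local-type bound (`GenuineM.absRamificationIdx_kOfM_dvd_of_triple_six/_ten`),
SAME certificate list `(e, A, a₀, N)` per divisor (abc-iut-w5-d236's desk search, re-checked here by `decide` exactly as on the K line; `RadRow.cover_of_prime`
BY NAME), now feeding `GenuineM.not_pilotKummerCompatHull_triple_of_radCerts`: the hull-level clause S_H FAILS at the summand-route M-level sharp setting of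
`T`'s OWN read-off ideles (`settingPrVolSharpM`, pinned reading) for every genuine Θ-volume datum `T` over the rational point and every choice of the free
context binders and Kummer datum. Rows: HOME/plan/rescue/R-W/M-TWIN-GAP.tsv (rw-num-lead) ∩ `AbcOfSGenuineKChosenDepthRadRowsReyssat`. NOT claimed: admissibility / Szpiro-badness / (P6) /
non-emptiness. HONEST SCOPE as in the parents: SHARP reading; per-label licence STRONGER than print; «refuted as typed» ≠ «refuted in print»; nothing
about the number-level Corollary; typed ≠ proved; instantiated ≠ endorsed; no abc claim. [cite: Mochizuki2012, IUTchIII Cor. 3.12 Step (xi-f) p. 184;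
IUTchIV Prop. 1.2 (i)(ii) p. 10, Cor. 2.2 (ii) proof p. 44–46] [cite: Serre1972, §1.11–§1.12] [cite: NeukirchANT1999, Ch. II (5.5)]
[claim: Mochizuki2012, status: disputed] for every IUT sentence quoted.
-/

noncomputable section

open Set Function NumberField IsDedekindDomain

namespace Summit.ABC.IUTFork.Conditional

open Thm311 Thm311.Real Cor312 Cor312Vol Cor312Prov Literature.IUT.LogThetaLattice Literature.IUT.LogVolume
  Literature.IUT.HodgeTheaters Literature.IUT.LogVolume.ThetaData Literature.IUT.LogVolume.Cor22
  Literature.NumberTheory.NumberFields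
open Literature.NumberTheory.GaloisRepresentations.Ultrametric
open Literature.NumberTheory.DiophantineGeometry Literature.NumberTheory.DiophantineGeometry.GenEll Summit.ABC.ABC.Theorems

/-- **M-LINE TWIN of `not_pilotKummerCompatHull_chosen_reyssat_of_le_149`** (abc-iut-w5-d236, `AbcOfSGenuineKChosenDepthRadRowsReyssat`): for every
listed `l` and EVERY genuine Θ-volume datum `T` over `(ratPoint (2 / 23 ^ 5), l)`, at the summand-route M-level sharp setting of `T`'s OWN read-off
ideles (`settingPrVolSharpM`, pinned reading — the per-datum object of the M window binder of `abc_of_SH_v11M_window`) the hull-level clause S_H FAILS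
for every choice of the free context binders and Kummer datum; deciding place `u` over `p = 23` (the K row's pole prime, SAME certificates `(e, A, a₀,
N)` per divisor of the local-type bound, closed by `decide`), via `GenuineM.not_pilotKummerCompatHull_triple_of_radCerts`. NOT claimed: admissibility
/ Szpiro-badness / (P6) / non-emptiness. [cite: Mochizuki2012, IUTchIII Cor. 3.12 Step (xi-f) p. 184; IUTchIV Prop. 1.2 (i)(ii) p. 10] [claim:
Mochizuki2012, status: disputed] -/
theorem GenuineM.not_pilotKummerCompatHull_reyssat_of_le_149_rad {l : ℕ}
    (hl : l = 29 ∨ l = 31 ∨ l = 37 ∨ l = 41 ∨ l = 43 ∨ l = 47 ∨ l = 53 ∨ l = 59 ∨ l = 61 ∨ l = 67 ∨ l = 71 ∨ l = 73 ∨ l = 79 ∨ l = 83 ∨ l = 89 ∨ l = 97 ∨ l = 101 ∨ l = 103 ∨ l = 107 ∨ l = 113 ∨ l = 127 ∨ l = 131 ∨ l = 137 ∨ l = 139 ∨ l = 149)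
    (T : Cor22.ThetaVolumeDatumAt (ratPoint (((2 : ℕ) : ℚ) / (23 ^ 5 : ℕ))) l) (u : FinitePlace ℚ) (hu : ratChar u = 23) :
    letI := T.instFieldF; letI := T.instNumberFieldF; letI := T.instAlgebraF; letI := T.instFieldK
    letI := T.instNumberFieldK; letI := T.instAlgebraK; letI := T.instFieldFbar; letI := T.instAlgebraFbar
    letI := T.instAlgebraKFbar; letI := T.instIsElliptic
    ∀ (M : Type) [Field M] [NumberField M]
      (archPk : ∀ (j : (thetaIndexOfInitial T.D).Label) (vQ : (thetaIndexOfInitial T.D).VQ),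
        Set ((logShellsOfInitialDH T.D (analyticLogvVal T.K)).Packet j vQ))
      (archSub : ∀ (j : (thetaIndexOfInitial T.D).Label) (v : (thetaIndexOfInitial T.D).V),
        Set ((logShellsOfInitialDH T.D (analyticLogvVal T.K)).Packet j ((thetaIndexOfInitial T.D).over v)))
      (Ψ : ℤ → ∀ v : (thetaIndexOfInitial T.D).V, v ∈ (thetaIndexOfInitial T.D).Vbad →
        Set ((logShellsOfInitialDH T.D (analyticLogvVal T.K)).StarPacket v))
      (act : ℤ → ∀ v : (thetaIndexOfInitial T.D).V, v ∈ (thetaIndexOfInitial T.D).Vbad →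
        (logShellsOfInitialDH T.D (analyticLogvVal T.K)).StarPacket v →
          Module.End ℚ ((logShellsOfInitialDH T.D (analyticLogvVal T.K)).StarPacket v))
      (Mmod : ℤ → ∀ j : (thetaIndexOfInitial T.D).LabelStar, Set ((logShellsOfInitialDH T.D (analyticLogvVal T.K)).GlobalPacket j.1))
      (region : ℤ → ∀ j : (thetaIndexOfInitial T.D).LabelStar, FinDivisor M → ∀ vQ : (thetaIndexOfInitial T.D).VQ,
        Set ((logShellsOfInitialDH T.D (analyticLogvVal T.K)).Packet j.1 vQ))
      (frobAdm : ℤ → ℤ → ∀ (j : (thetaIndexOfInitial T.D).Label) (vQ : (thetaIndexOfInitial T.D).VQ),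
        Set ((logShellsOfInitialDH T.D (analyticLogvVal T.K)).Packet j vQ) → Prop)
      (frobLogvol : ℤ → ℤ → ∀ (j : (thetaIndexOfInitial T.D).Label) (vQ : (thetaIndexOfInitial T.D).VQ),
        Set ((logShellsOfInitialDH T.D (analyticLogvVal T.K)).Packet j vQ) → ℝ)
      (frobΨ : ℤ → ℤ → ∀ v : (thetaIndexOfInitial T.D).V, v ∈ (thetaIndexOfInitial T.D).Vbad →
        Set ((logShellsOfInitialDH T.D (analyticLogvVal T.K)).StarPacket v))
      (frobMmod : ℤ → ℤ → ∀ j : (thetaIndexOfInitial T.D).LabelStar, Set ((logShellsOfInitialDH T.D (analyticLogvVal T.K)).GlobalPacket j.1))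
      (unitImage : ℤ → ℤ → ℕ → ∀ (j : (thetaIndexOfInitial T.D).Label) (vQ : (thetaIndexOfInitial T.D).VQ),
        Set ((logShellsOfInitialDH T.D (analyticLogvVal T.K)).Packet j vQ))
      (ballImage : ℤ → ℤ → ∀ (j : (thetaIndexOfInitial T.D).Label) (vQ : (thetaIndexOfInitial T.D).VQ),
        Set ((logShellsOfInitialDH T.D (analyticLogvVal T.K)).Packet j vQ))
      (thetaDiv : ℤ → ℤ → LgpDivisor M (thetaIndexOfInitial T.D).lstar)
      (n : ℤ) {HT : Type} {LogLink : HT → HT → Type} {IsFull : ∀ {s t : HT}, LogLink s t → Prop}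
      (lat : LGPGaussianLogThetaLattice LogLink IsFull)
      {Frd : Type} {IsoF : Frd → Frd → Type} {Ob : Frd → Type} {realify : Frd → Frd} {Strip : Type}
      {IsoS : Strip → Strip → Type} {Mv : ∀ v : (thetaIndexOfInitial T.D).V, v ∈ (thetaIndexOfInitial T.D).Vbad → Type}
      [∀ v h, Monoid (Mv v h)]
      (sig : GlobalLGPFrobenioidSignature (thetaIndexOfInitial T.D).lstar (thetaIndexOfInitial T.D).V
        (· ∈ (thetaIndexOfInitial T.D).Vbad) Frd IsoF Ob realify Strip IsoS Mv)
      (split : SplittingMonoids Mv) {ObΔ : Type} {N : ∀ v : (thetaIndexOfInitial T.D).V, v ∈ (thetaIndexOfInitial T.D).Vbad → Type}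
      [∀ v h, Monoid (N v h)] (qData : QPilotData ObΔ N)
      (qK : ∀ v : (thetaIndexOfInitial T.D).V, v ∈ (thetaIndexOfInitial T.D).Vbad →
        Set ((logShellsOfInitialDH T.D (analyticLogvVal T.K)).StarPacket v)),
      ¬ Cor312Vol.PilotKummerCompatHull
        (LatticeSituation.ofShells (logShellsOfInitialDH T.D (analyticLogvVal T.K)) M archPk archSub
          (summandPiecesPrM T.D (logvAnalyticVal_analyticLogvVal (K := T.K))).Adm (summandPiecesPrM T.D (logvAnalyticVal_analyticLogvVal (K := T.K))).logvol Ψ act Mmod region frobAdm frobLogvol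
          frobΨ frobMmod unitImage ballImage thetaDiv)
        (settingPrVolSharpM T.D (logvAnalyticVal_analyticLogvVal (K := T.K)) (tOfIdeleData T.D (ideleDataOf T.D T.isVolumeInputOf))
          (fun u x => tqM T.D (ratChar u) u (natCast_ratChar_mem u) (ideleDataOf T.D T.isVolumeInputOf) x) M archPk archSub Ψ act Mmod region n lat sig split qData
          (fun u x => tqM_ne_zero T.D (ratChar u) u (natCast_ratChar_mem u) (ideleDataOf T.D T.isVolumeInputOf) x)
          (GenuineM.finite_ratPlaces_under_S T.D).toFinset
          (fun u x hu => norm_tqM_eq_one_of_not_mem T.D (ratChar u) u (natCast_ratChar_mem u) (ideleDataOf T.D T.isVolumeInputOf) x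
            fun hx => hu ((Set.Finite.mem_toFinset _).mpr ⟨x, hx⟩)))
        (fun _ => Cor312.Setting.qRegion
          (settingPrVolSharpM T.D (logvAnalyticVal_analyticLogvVal (K := T.K)) (tOfIdeleData T.D (ideleDataOf T.D T.isVolumeInputOf))
          (fun u x => tqM T.D (ratChar u) u (natCast_ratChar_mem u) (ideleDataOf T.D T.isVolumeInputOf) x) M archPk archSub Ψ act Mmod region n lat sig split qData
          (fun u x => tqM_ne_zero T.D (ratChar u) u (natCast_ratChar_mem u) (ideleDataOf T.D T.isVolumeInputOf) x)
          (GenuineM.finite_ratPlaces_under_S T.D).toFinset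
          (fun u x hu => norm_tqM_eq_one_of_not_mem T.D (ratChar u) u (natCast_ratChar_mem u) (ideleDataOf T.D T.isVolumeInputOf) x
            fun hx => hu ((Set.Finite.mem_toFinset _).mpr ⟨x, hx⟩)))) qK := by
  rcases hl with rfl | rfl | rfl | rfl | rfl | rfl | rfl | rfl | rfl | rfl | rfl | rfl | rfl | rfl | rfl | rfl | rfl | rfl | rfl | rfl | rfl | rfl | rfl | rfl | rfl
  · -- `l = 29`: `p = 23`, `v = 5`, label `j = 14`, local type `e ∣ 6 * 29`
    exact GenuineM.not_pilotKummerCompatHull_triple_of_radCerts (b := 3 ^ 10 * 109) Literature.Barriers.ABC.reyssat_isABCTriple T u 23 hu (by norm_num)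
      (by norm_num) 5 (by norm_num) (by norm_num) (by norm_num) 13 (by norm_num) (6 * 29) (by norm_num)
      (GenuineM.absRamificationIdx_kOfM_dvd_of_triple_six (b := 3 ^ 10 * 109) (v := 5) Literature.Barriers.ABC.reyssat_isABCTriple T u 23 hu (by norm_num) (by norm_num)
        (by norm_num) (by norm_num) (by norm_num) (by norm_num) (by norm_num) (by norm_num : 5 ∣ 5))
      [(1, 1, 0, 18), (2, 1, 0, 19), (3, 1, 0, 19), (6, 1, 0, 19), (29, 2, 1, 19), (58, 3, 1, 19), (87, 5, 1, 19), (174, 9, 1, 19)]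
      (RadRow.cover_of_prime (D := 6) (l := 29) (by norm_num) (by norm_num) _ (by decide) (by decide)) (by decide)
  · -- `l = 31`: `p = 23`, `v = 5`, label `j = 15`, local type `e ∣ 6 * 31`
    exact GenuineM.not_pilotKummerCompatHull_triple_of_radCerts (b := 3 ^ 10 * 109) Literature.Barriers.ABC.reyssat_isABCTriple T u 23 hu (by norm_num)
      (by norm_num) 5 (by norm_num) (by norm_num) (by norm_num) 14 (by norm_num) (6 * 31) (by norm_num)
      (GenuineM.absRamificationIdx_kOfM_dvd_of_triple_six (b := 3 ^ 10 * 109) (v := 5) Literature.Barriers.ABC.reyssat_isABCTriple T u 23 hu (by norm_num) (by norm_num)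
        (by norm_num) (by norm_num) (by norm_num) (by norm_num) (by norm_num) (by norm_num : 5 ∣ 5))
      [(1, 1, 0, 20), (2, 1, 0, 20), (3, 1, 0, 20), (6, 1, 0, 21), (31, 2, 1, 20), (62, 3, 1, 20), (93, 5, 1, 20), (186, 9, 1, 20)]
      (RadRow.cover_of_prime (D := 6) (l := 31) (by norm_num) (by norm_num) _ (by decide) (by decide)) (by decide)
  · -- `l = 37`: `p = 23`, `v = 5`, label `j = 18`, local type `e ∣ 6 * 37`
    exact GenuineM.not_pilotKummerCompatHull_triple_of_radCerts (b := 3 ^ 10 * 109) Literature.Barriers.ABC.reyssat_isABCTriple T u 23 hu (by norm_num)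
      (by norm_num) 5 (by norm_num) (by norm_num) (by norm_num) 17 (by norm_num) (6 * 37) (by norm_num)
      (GenuineM.absRamificationIdx_kOfM_dvd_of_triple_six (b := 3 ^ 10 * 109) (v := 5) Literature.Barriers.ABC.reyssat_isABCTriple T u 23 hu (by norm_num) (by norm_num)
        (by norm_num) (by norm_num) (by norm_num) (by norm_num) (by norm_num) (by norm_num : 5 ∣ 5))
      [(1, 1, 0, 24), (2, 1, 0, 25), (3, 1, 0, 25), (6, 1, 0, 25), (37, 2, 1, 25), (74, 4, 1, 25), (111, 6, 1, 24), (222, 11, 1, 24)]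
      (RadRow.cover_of_prime (D := 6) (l := 37) (by norm_num) (by norm_num) _ (by decide) (by decide)) (by decide)
  · -- `l = 41`: `p = 23`, `v = 5`, label `j = 20`, local type `e ∣ 6 * 41`
    exact GenuineM.not_pilotKummerCompatHull_triple_of_radCerts (b := 3 ^ 10 * 109) Literature.Barriers.ABC.reyssat_isABCTriple T u 23 hu (by norm_num)
      (by norm_num) 5 (by norm_num) (by norm_num) (by norm_num) 19 (by norm_num) (6 * 41) (by norm_num)
      (GenuineM.absRamificationIdx_kOfM_dvd_of_triple_six (b := 3 ^ 10 * 109) (v := 5) Literature.Barriers.ABC.reyssat_isABCTriple T u 23 hu (by norm_num) (by norm_num)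
        (by norm_num) (by norm_num) (by norm_num) (by norm_num) (by norm_num) (by norm_num : 5 ∣ 5))
      [(1, 1, 0, 27), (2, 1, 0, 28), (3, 1, 0, 28), (6, 1, 0, 28), (41, 2, 1, 28), (82, 4, 1, 28), (123, 6, 1, 27), (246, 12, 1, 27)]
      (RadRow.cover_of_prime (D := 6) (l := 41) (by norm_num) (by norm_num) _ (by decide) (by decide)) (by decide)
  · -- `l = 43`: `p = 23`, `v = 5`, label `j = 21`, local type `e ∣ 6 * 43`
    exact GenuineM.not_pilotKummerCompatHull_triple_of_radCerts (b := 3 ^ 10 * 109) Literature.Barriers.ABC.reyssat_isABCTriple T u 23 hu (by norm_num)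
      (by norm_num) 5 (by norm_num) (by norm_num) (by norm_num) 20 (by norm_num) (6 * 43) (by norm_num)
      (GenuineM.absRamificationIdx_kOfM_dvd_of_triple_six (b := 3 ^ 10 * 109) (v := 5) Literature.Barriers.ABC.reyssat_isABCTriple T u 23 hu (by norm_num) (by norm_num)
        (by norm_num) (by norm_num) (by norm_num) (by norm_num) (by norm_num) (by norm_num : 5 ∣ 5))
      [(1, 1, 0, 29), (2, 1, 0, 29), (3, 1, 0, 29), (6, 1, 0, 30), (43, 3, 1, 29), (86, 5, 1, 29), (129, 7, 1, 29), (258, 13, 1, 29)]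
      (RadRow.cover_of_prime (D := 6) (l := 43) (by norm_num) (by norm_num) _ (by decide) (by decide)) (by decide)
  · -- `l = 47`: `p = 23`, `v = 5`, label `j = 23`, local type `e ∣ 6 * 47`
    exact GenuineM.not_pilotKummerCompatHull_triple_of_radCerts (b := 3 ^ 10 * 109) Literature.Barriers.ABC.reyssat_isABCTriple T u 23 hu (by norm_num)
      (by norm_num) 5 (by norm_num) (by norm_num) (by norm_num) 22 (by norm_num) (6 * 47) (by norm_num)
      (GenuineM.absRamificationIdx_kOfM_dvd_of_triple_six (b := 3 ^ 10 * 109) (v := 5) Literature.Barriers.ABC.reyssat_isABCTriple T u 23 hu (by norm_num) (by norm_num)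
        (by norm_num) (by norm_num) (by norm_num) (by norm_num) (by norm_num) (by norm_num : 5 ∣ 5))
      [(1, 1, 0, 32), (2, 1, 0, 32), (3, 1, 0, 32), (6, 1, 0, 33), (47, 3, 1, 32), (94, 5, 1, 32), (141, 7, 1, 32), (282, 14, 1, 32)]
      (RadRow.cover_of_prime (D := 6) (l := 47) (by norm_num) (by norm_num) _ (by decide) (by decide)) (by decide)
  · -- `l = 53`: `p = 23`, `v = 5`, label `j = 26`, local type `e ∣ 6 * 53`
    exact GenuineM.not_pilotKummerCompatHull_triple_of_radCerts (b := 3 ^ 10 * 109) Literature.Barriers.ABC.reyssat_isABCTriple T u 23 hu (by norm_num)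
      (by norm_num) 5 (by norm_num) (by norm_num) (by norm_num) 25 (by norm_num) (6 * 53) (by norm_num)
      (GenuineM.absRamificationIdx_kOfM_dvd_of_triple_six (b := 3 ^ 10 * 109) (v := 5) Literature.Barriers.ABC.reyssat_isABCTriple T u 23 hu (by norm_num) (by norm_num)
        (by norm_num) (by norm_num) (by norm_num) (by norm_num) (by norm_num) (by norm_num : 5 ∣ 5))
      [(1, 1, 0, 36), (2, 1, 0, 37), (3, 1, 0, 37), (6, 1, 0, 37), (53, 3, 1, 36), (106, 6, 1, 36), (159, 8, 1, 36), (318, 16, 1, 36)]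
      (RadRow.cover_of_prime (D := 6) (l := 53) (by norm_num) (by norm_num) _ (by decide) (by decide)) (by decide)
  · -- `l = 59`: `p = 23`, `v = 5`, label `j = 29`, local type `e ∣ 6 * 59`
    exact GenuineM.not_pilotKummerCompatHull_triple_of_radCerts (b := 3 ^ 10 * 109) Literature.Barriers.ABC.reyssat_isABCTriple T u 23 hu (by norm_num)
      (by norm_num) 5 (by norm_num) (by norm_num) (by norm_num) 28 (by norm_num) (6 * 59) (by norm_num)
      (GenuineM.absRamificationIdx_kOfM_dvd_of_triple_six (b := 3 ^ 10 * 109) (v := 5) Literature.Barriers.ABC.reyssat_isABCTriple T u 23 hu (by norm_num) (by norm_num)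
        (by norm_num) (by norm_num) (by norm_num) (by norm_num) (by norm_num) (by norm_num : 5 ∣ 5))
      [(1, 1, 0, 41), (2, 1, 0, 41), (3, 1, 0, 41), (6, 1, 0, 42), (59, 3, 1, 41), (118, 6, 1, 40), (177, 9, 1, 40), (354, 17, 1, 40)]
      (RadRow.cover_of_prime (D := 6) (l := 59) (by norm_num) (by norm_num) _ (by decide) (by decide)) (by decide)
  · -- `l = 61`: `p = 23`, `v = 5`, label `j = 30`, local type `e ∣ 6 * 61`
    exact GenuineM.not_pilotKummerCompatHull_triple_of_radCerts (b := 3 ^ 10 * 109) Literature.Barriers.ABC.reyssat_isABCTriple T u 23 hu (by norm_num)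
      (by norm_num) 5 (by norm_num) (by norm_num) (by norm_num) 29 (by norm_num) (6 * 61) (by norm_num)
      (GenuineM.absRamificationIdx_kOfM_dvd_of_triple_six (b := 3 ^ 10 * 109) (v := 5) Literature.Barriers.ABC.reyssat_isABCTriple T u 23 hu (by norm_num) (by norm_num)
        (by norm_num) (by norm_num) (by norm_num) (by norm_num) (by norm_num) (by norm_num : 5 ∣ 5))
      [(1, 1, 0, 42), (2, 1, 0, 43), (3, 1, 0, 43), (6, 1, 0, 43), (61, 3, 1, 42), (122, 6, 1, 42), (183, 9, 1, 42), (366, 18, 1, 42)]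
      (RadRow.cover_of_prime (D := 6) (l := 61) (by norm_num) (by norm_num) _ (by decide) (by decide)) (by decide)
  · -- `l = 67`: `p = 23`, `v = 5`, label `j = 33`, local type `e ∣ 6 * 67`
    exact GenuineM.not_pilotKummerCompatHull_triple_of_radCerts (b := 3 ^ 10 * 109) Literature.Barriers.ABC.reyssat_isABCTriple T u 23 hu (by norm_num)
      (by norm_num) 5 (by norm_num) (by norm_num) (by norm_num) 32 (by norm_num) (6 * 67) (by norm_num)
      (GenuineM.absRamificationIdx_kOfM_dvd_of_triple_six (b := 3 ^ 10 * 109) (v := 5) Literature.Barriers.ABC.reyssat_isABCTriple T u 23 hu (by norm_num) (by norm_num)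
        (by norm_num) (by norm_num) (by norm_num) (by norm_num) (by norm_num) (by norm_num : 5 ∣ 5))
      [(1, 1, 0, 47), (2, 1, 0, 47), (3, 1, 0, 47), (6, 1, 0, 48), (67, 4, 1, 46), (134, 7, 1, 46), (201, 10, 1, 46), (402, 20, 1, 46)]
      (RadRow.cover_of_prime (D := 6) (l := 67) (by norm_num) (by norm_num) _ (by decide) (by decide)) (by decide)
  · -- `l = 71`: `p = 23`, `v = 5`, label `j = 35`, local type `e ∣ 6 * 71`
    exact GenuineM.not_pilotKummerCompatHull_triple_of_radCerts (b := 3 ^ 10 * 109) Literature.Barriers.ABC.reyssat_isABCTriple T u 23 hu (by norm_num)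
      (by norm_num) 5 (by norm_num) (by norm_num) (by norm_num) 34 (by norm_num) (6 * 71) (by norm_num)
      (GenuineM.absRamificationIdx_kOfM_dvd_of_triple_six (b := 3 ^ 10 * 109) (v := 5) Literature.Barriers.ABC.reyssat_isABCTriple T u 23 hu (by norm_num) (by norm_num)
        (by norm_num) (by norm_num) (by norm_num) (by norm_num) (by norm_num) (by norm_num : 5 ∣ 5))
      [(1, 1, 0, 50), (2, 1, 0, 50), (3, 1, 0, 50), (6, 1, 0, 51), (71, 4, 1, 49), (142, 7, 1, 49), (213, 11, 1, 49), (426, 21, 1, 49)]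
      (RadRow.cover_of_prime (D := 6) (l := 71) (by norm_num) (by norm_num) _ (by decide) (by decide)) (by decide)
  · -- `l = 73`: `p = 23`, `v = 5`, label `j = 36`, local type `e ∣ 6 * 73`
    exact GenuineM.not_pilotKummerCompatHull_triple_of_radCerts (b := 3 ^ 10 * 109) Literature.Barriers.ABC.reyssat_isABCTriple T u 23 hu (by norm_num)
      (by norm_num) 5 (by norm_num) (by norm_num) (by norm_num) 35 (by norm_num) (6 * 73) (by norm_num)
      (GenuineM.absRamificationIdx_kOfM_dvd_of_triple_six (b := 3 ^ 10 * 109) (v := 5) Literature.Barriers.ABC.reyssat_isABCTriple T u 23 hu (by norm_num) (by norm_num)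
        (by norm_num) (by norm_num) (by norm_num) (by norm_num) (by norm_num) (by norm_num : 5 ∣ 5))
      [(1, 1, 0, 51), (2, 1, 0, 52), (3, 1, 0, 52), (6, 1, 0, 52), (73, 4, 1, 51), (146, 7, 1, 51), (219, 11, 1, 51), (438, 21, 1, 51)]
      (RadRow.cover_of_prime (D := 6) (l := 73) (by norm_num) (by norm_num) _ (by decide) (by decide)) (by decide)
  · -- `l = 79`: `p = 23`, `v = 5`, label `j = 39`, local type `e ∣ 6 * 79`
    exact GenuineM.not_pilotKummerCompatHull_triple_of_radCerts (b := 3 ^ 10 * 109) Literature.Barriers.ABC.reyssat_isABCTriple T u 23 hu (by norm_num)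
      (by norm_num) 5 (by norm_num) (by norm_num) (by norm_num) 38 (by norm_num) (6 * 79) (by norm_num)
      (GenuineM.absRamificationIdx_kOfM_dvd_of_triple_six (b := 3 ^ 10 * 109) (v := 5) Literature.Barriers.ABC.reyssat_isABCTriple T u 23 hu (by norm_num) (by norm_num)
        (by norm_num) (by norm_num) (by norm_num) (by norm_num) (by norm_num) (by norm_num : 5 ∣ 5))
      [(1, 1, 0, 56), (2, 1, 0, 56), (3, 1, 0, 56), (6, 1, 0, 57), (79, 4, 1, 55), (158, 8, 1, 55), (237, 12, 1, 55), (474, 23, 1, 55)]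
      (RadRow.cover_of_prime (D := 6) (l := 79) (by norm_num) (by norm_num) _ (by decide) (by decide)) (by decide)
  · -- `l = 83`: `p = 23`, `v = 5`, label `j = 41`, local type `e ∣ 6 * 83`
    exact GenuineM.not_pilotKummerCompatHull_triple_of_radCerts (b := 3 ^ 10 * 109) Literature.Barriers.ABC.reyssat_isABCTriple T u 23 hu (by norm_num)
      (by norm_num) 5 (by norm_num) (by norm_num) (by norm_num) 40 (by norm_num) (6 * 83) (by norm_num)
      (GenuineM.absRamificationIdx_kOfM_dvd_of_triple_six (b := 3 ^ 10 * 109) (v := 5) Literature.Barriers.ABC.reyssat_isABCTriple T u 23 hu (by norm_num) (by norm_num)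
        (by norm_num) (by norm_num) (by norm_num) (by norm_num) (by norm_num) (by norm_num : 5 ∣ 5))
      [(1, 1, 0, 59), (2, 1, 0, 59), (3, 1, 0, 59), (6, 1, 0, 60), (83, 4, 1, 58), (166, 8, 1, 58), (249, 12, 1, 58), (498, 24, 1, 58)]
      (RadRow.cover_of_prime (D := 6) (l := 83) (by norm_num) (by norm_num) _ (by decide) (by decide)) (by decide)
  · -- `l = 89`: `p = 23`, `v = 5`, label `j = 44`, local type `e ∣ 6 * 89`
    exact GenuineM.not_pilotKummerCompatHull_triple_of_radCerts (b := 3 ^ 10 * 109) Literature.Barriers.ABC.reyssat_isABCTriple T u 23 hu (by norm_num)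
      (by norm_num) 5 (by norm_num) (by norm_num) (by norm_num) 43 (by norm_num) (6 * 89) (by norm_num)
      (GenuineM.absRamificationIdx_kOfM_dvd_of_triple_six (b := 3 ^ 10 * 109) (v := 5) Literature.Barriers.ABC.reyssat_isABCTriple T u 23 hu (by norm_num) (by norm_num)
        (by norm_num) (by norm_num) (by norm_num) (by norm_num) (by norm_num) (by norm_num : 5 ∣ 5))
      [(1, 1, 0, 63), (2, 1, 0, 64), (3, 1, 0, 64), (6, 1, 0, 64), (89, 5, 1, 62), (178, 9, 1, 62), (267, 13, 1, 62), (534, 26, 2, 62)]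
      (RadRow.cover_of_prime (D := 6) (l := 89) (by norm_num) (by norm_num) _ (by decide) (by decide)) (by decide)
  · -- `l = 97`: `p = 23`, `v = 5`, label `j = 48`, local type `e ∣ 6 * 97`
    exact GenuineM.not_pilotKummerCompatHull_triple_of_radCerts (b := 3 ^ 10 * 109) Literature.Barriers.ABC.reyssat_isABCTriple T u 23 hu (by norm_num)
      (by norm_num) 5 (by norm_num) (by norm_num) (by norm_num) 47 (by norm_num) (6 * 97) (by norm_num)
      (GenuineM.absRamificationIdx_kOfM_dvd_of_triple_six (b := 3 ^ 10 * 109) (v := 5) Literature.Barriers.ABC.reyssat_isABCTriple T u 23 hu (by norm_num) (by norm_num)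
        (by norm_num) (by norm_num) (by norm_num) (by norm_num) (by norm_num) (by norm_num : 5 ∣ 5))
      [(1, 1, 0, 69), (2, 1, 0, 70), (3, 1, 0, 70), (6, 1, 0, 70), (97, 5, 1, 68), (194, 10, 1, 68), (291, 14, 1, 68), (582, 28, 2, 68)]
      (RadRow.cover_of_prime (D := 6) (l := 97) (by norm_num) (by norm_num) _ (by decide) (by decide)) (by decide)
  · -- `l = 101`: `p = 23`, `v = 5`, label `j = 50`, local type `e ∣ 6 * 101`
    exact GenuineM.not_pilotKummerCompatHull_triple_of_radCerts (b := 3 ^ 10 * 109) Literature.Barriers.ABC.reyssat_isABCTriple T u 23 hu (by norm_num)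
      (by norm_num) 5 (by norm_num) (by norm_num) (by norm_num) 49 (by norm_num) (6 * 101) (by norm_num)
      (GenuineM.absRamificationIdx_kOfM_dvd_of_triple_six (b := 3 ^ 10 * 109) (v := 5) Literature.Barriers.ABC.reyssat_isABCTriple T u 23 hu (by norm_num) (by norm_num)
        (by norm_num) (by norm_num) (by norm_num) (by norm_num) (by norm_num) (by norm_num : 5 ∣ 5))
      [(1, 1, 0, 72), (2, 1, 0, 73), (3, 1, 0, 73), (6, 1, 0, 73), (101, 5, 1, 71), (202, 10, 1, 71), (303, 15, 1, 71), (606, 29, 2, 71)]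
      (RadRow.cover_of_prime (D := 6) (l := 101) (by norm_num) (by norm_num) _ (by decide) (by decide)) (by decide)
  · -- `l = 103`: `p = 23`, `v = 5`, label `j = 51`, local type `e ∣ 6 * 103`
    exact GenuineM.not_pilotKummerCompatHull_triple_of_radCerts (b := 3 ^ 10 * 109) Literature.Barriers.ABC.reyssat_isABCTriple T u 23 hu (by norm_num)
      (by norm_num) 5 (by norm_num) (by norm_num) (by norm_num) 50 (by norm_num) (6 * 103) (by norm_num)
      (GenuineM.absRamificationIdx_kOfM_dvd_of_triple_six (b := 3 ^ 10 * 109) (v := 5) Literature.Barriers.ABC.reyssat_isABCTriple T u 23 hu (by norm_num) (by norm_num)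
        (by norm_num) (by norm_num) (by norm_num) (by norm_num) (by norm_num) (by norm_num : 5 ∣ 5))
      [(1, 1, 0, 74), (2, 1, 0, 74), (3, 1, 0, 74), (6, 1, 0, 75), (103, 5, 1, 73), (206, 10, 1, 72), (309, 15, 1, 72), (618, 30, 2, 72)]
      (RadRow.cover_of_prime (D := 6) (l := 103) (by norm_num) (by norm_num) _ (by decide) (by decide)) (by decide)
  · -- `l = 107`: `p = 23`, `v = 5`, label `j = 53`, local type `e ∣ 6 * 107`
    exact GenuineM.not_pilotKummerCompatHull_triple_of_radCerts (b := 3 ^ 10 * 109) Literature.Barriers.ABC.reyssat_isABCTriple T u 23 hu (by norm_num)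
      (by norm_num) 5 (by norm_num) (by norm_num) (by norm_num) 52 (by norm_num) (6 * 107) (by norm_num)
      (GenuineM.absRamificationIdx_kOfM_dvd_of_triple_six (b := 3 ^ 10 * 109) (v := 5) Literature.Barriers.ABC.reyssat_isABCTriple T u 23 hu (by norm_num) (by norm_num)
        (by norm_num) (by norm_num) (by norm_num) (by norm_num) (by norm_num) (by norm_num : 5 ∣ 5))
      [(1, 1, 0, 77), (2, 1, 0, 77), (3, 1, 0, 77), (6, 1, 0, 78), (107, 6, 1, 75), (214, 11, 1, 75), (321, 16, 1, 75), (642, 31, 2, 75)]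
      (RadRow.cover_of_prime (D := 6) (l := 107) (by norm_num) (by norm_num) _ (by decide) (by decide)) (by decide)
  · -- `l = 113`: `p = 23`, `v = 5`, label `j = 56`, local type `e ∣ 6 * 113`
    exact GenuineM.not_pilotKummerCompatHull_triple_of_radCerts (b := 3 ^ 10 * 109) Literature.Barriers.ABC.reyssat_isABCTriple T u 23 hu (by norm_num)
      (by norm_num) 5 (by norm_num) (by norm_num) (by norm_num) 55 (by norm_num) (6 * 113) (by norm_num)
      (GenuineM.absRamificationIdx_kOfM_dvd_of_triple_six (b := 3 ^ 10 * 109) (v := 5) Literature.Barriers.ABC.reyssat_isABCTriple T u 23 hu (by norm_num) (by norm_num)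
        (by norm_num) (by norm_num) (by norm_num) (by norm_num) (by norm_num) (by norm_num : 5 ∣ 5))
      [(1, 1, 0, 81), (2, 1, 0, 82), (3, 1, 0, 82), (6, 1, 0, 82), (113, 6, 1, 80), (226, 11, 1, 80), (339, 17, 1, 80), (678, 33, 2, 80)]
      (RadRow.cover_of_prime (D := 6) (l := 113) (by norm_num) (by norm_num) _ (by decide) (by decide)) (by decide)
  · -- `l = 127`: `p = 23`, `v = 5`, label `j = 63`, local type `e ∣ 6 * 127`
    exact GenuineM.not_pilotKummerCompatHull_triple_of_radCerts (b := 3 ^ 10 * 109) Literature.Barriers.ABC.reyssat_isABCTriple T u 23 hu (by norm_num)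
      (by norm_num) 5 (by norm_num) (by norm_num) (by norm_num) 62 (by norm_num) (6 * 127) (by norm_num)
      (GenuineM.absRamificationIdx_kOfM_dvd_of_triple_six (b := 3 ^ 10 * 109) (v := 5) Literature.Barriers.ABC.reyssat_isABCTriple T u 23 hu (by norm_num) (by norm_num)
        (by norm_num) (by norm_num) (by norm_num) (by norm_num) (by norm_num) (by norm_num : 5 ∣ 5))
      [(1, 1, 0, 92), (2, 1, 0, 92), (3, 1, 0, 92), (6, 1, 0, 93), (127, 7, 1, 90), (254, 13, 1, 90), (381, 19, 1, 90), (762, 37, 2, 90)]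
      (RadRow.cover_of_prime (D := 6) (l := 127) (by norm_num) (by norm_num) _ (by decide) (by decide)) (by decide)
  · -- `l = 131`: `p = 23`, `v = 5`, label `j = 65`, local type `e ∣ 6 * 131`
    exact GenuineM.not_pilotKummerCompatHull_triple_of_radCerts (b := 3 ^ 10 * 109) Literature.Barriers.ABC.reyssat_isABCTriple T u 23 hu (by norm_num)
      (by norm_num) 5 (by norm_num) (by norm_num) (by norm_num) 64 (by norm_num) (6 * 131) (by norm_num)
      (GenuineM.absRamificationIdx_kOfM_dvd_of_triple_six (b := 3 ^ 10 * 109) (v := 5) Literature.Barriers.ABC.reyssat_isABCTriple T u 23 hu (by norm_num) (by norm_num)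
        (by norm_num) (by norm_num) (by norm_num) (by norm_num) (by norm_num) (by norm_num : 5 ∣ 5))
      [(1, 1, 0, 95), (2, 1, 0, 95), (3, 1, 0, 95), (6, 1, 0, 96), (131, 7, 1, 93), (262, 13, 1, 93), (393, 19, 1, 93), (786, 38, 2, 93)]
      (RadRow.cover_of_prime (D := 6) (l := 131) (by norm_num) (by norm_num) _ (by decide) (by decide)) (by decide)
  · -- `l = 137`: `p = 23`, `v = 5`, label `j = 68`, local type `e ∣ 6 * 137`
    exact GenuineM.not_pilotKummerCompatHull_triple_of_radCerts (b := 3 ^ 10 * 109) Literature.Barriers.ABC.reyssat_isABCTriple T u 23 hu (by norm_num)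
      (by norm_num) 5 (by norm_num) (by norm_num) (by norm_num) 67 (by norm_num) (6 * 137) (by norm_num)
      (GenuineM.absRamificationIdx_kOfM_dvd_of_triple_six (b := 3 ^ 10 * 109) (v := 5) Literature.Barriers.ABC.reyssat_isABCTriple T u 23 hu (by norm_num) (by norm_num)
        (by norm_num) (by norm_num) (by norm_num) (by norm_num) (by norm_num) (by norm_num : 5 ∣ 5))
      [(1, 1, 0, 99), (2, 1, 0, 100), (3, 1, 0, 100), (6, 1, 0, 100), (137, 7, 1, 97), (274, 14, 1, 97), (411, 20, 1, 97), (822, 40, 2, 97)]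
      (RadRow.cover_of_prime (D := 6) (l := 137) (by norm_num) (by norm_num) _ (by decide) (by decide)) (by decide)
  · -- `l = 139`: `p = 23`, `v = 5`, label `j = 69`, local type `e ∣ 6 * 139`
    exact GenuineM.not_pilotKummerCompatHull_triple_of_radCerts (b := 3 ^ 10 * 109) Literature.Barriers.ABC.reyssat_isABCTriple T u 23 hu (by norm_num)
      (by norm_num) 5 (by norm_num) (by norm_num) (by norm_num) 68 (by norm_num) (6 * 139) (by norm_num)
      (GenuineM.absRamificationIdx_kOfM_dvd_of_triple_six (b := 3 ^ 10 * 109) (v := 5) Literature.Barriers.ABC.reyssat_isABCTriple T u 23 hu (by norm_num) (by norm_num)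
        (by norm_num) (by norm_num) (by norm_num) (by norm_num) (by norm_num) (by norm_num : 5 ∣ 5))
      [(1, 1, 0, 101), (2, 1, 0, 101), (3, 1, 0, 101), (6, 1, 0, 102), (139, 7, 1, 99), (278, 14, 1, 98), (417, 20, 1, 99), (834, 40, 2, 98)]
      (RadRow.cover_of_prime (D := 6) (l := 139) (by norm_num) (by norm_num) _ (by decide) (by decide)) (by decide)
  · -- `l = 149`: `p = 23`, `v = 5`, label `j = 74`, local type `e ∣ 6 * 149`
    exact GenuineM.not_pilotKummerCompatHull_triple_of_radCerts (b := 3 ^ 10 * 109) Literature.Barriers.ABC.reyssat_isABCTriple T u 23 hu (by norm_num)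
      (by norm_num) 5 (by norm_num) (by norm_num) (by norm_num) 73 (by norm_num) (6 * 149) (by norm_num)
      (GenuineM.absRamificationIdx_kOfM_dvd_of_triple_six (b := 3 ^ 10 * 109) (v := 5) Literature.Barriers.ABC.reyssat_isABCTriple T u 23 hu (by norm_num) (by norm_num)
        (by norm_num) (by norm_num) (by norm_num) (by norm_num) (by norm_num) (by norm_num : 5 ∣ 5))
      [(1, 1, 0, 108), (2, 1, 0, 109), (3, 1, 0, 109), (6, 1, 0, 109), (149, 8, 1, 106), (298, 15, 1, 106), (447, 22, 1, 106), (894, 43, 2, 106)]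
      (RadRow.cover_of_prime (D := 6) (l := 149) (by norm_num) (by norm_num) _ (by decide) (by decide)) (by decide)

/-- **M-LINE TWINS of abc-iut-w5-d236's Reyssat rows at `l = 13, 17, 19`** (K: `GenuineK.not_pilotKummerCompatHull_chosen_reyssat_thirteen` p466042,
`…_seventeen` / `…_nineteen` p466771 — `AbcOfSGenuineKChosenDepthRadRows1/2`, the last three RAD rows of the R-W numerics lead's M-TWIN-GAP.tsv):
triple `2 + 3¹⁰·109 = 23⁵`; deciding place `u` over `p = 23` (`v = 5`, `h = 10`, local type `e ∣ 6·l` by `GenuineM.absRamificationIdx_kOfM_dvd_of_triple_six`),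
top label `j = l⋆` (`i₀ = 5, 7, 8`), certificates `(e, A, a₀, N)` per divisor of `6·l` (this seat's desk search, same validity predicate as the K rows,
closed by `decide`): for every listed `l` and EVERY genuine Θ-volume datum `T` over `(ratPoint (2 / 23 ^ 5), l)` the hull-level clause S_H FAILS at the
summand-route M-level sharp setting of `T`'s OWN read-off ideles (`settingPrVolSharpM`, pinned reading) for every choice of the free context binders and
Kummer datum. NOT claimed: admissibility / Szpiro-badness / (P6) / non-emptiness. [cite: Mochizuki2012, IUTchIII Cor. 3.12 Step (xi-f) p. 184;
IUTchIV Prop. 1.2 (i)(ii) p. 10] [claim: Mochizuki2012, status: disputed] -/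
theorem GenuineM.not_pilotKummerCompatHull_reyssat_le_19_rad {l : ℕ} (hl : l = 13 ∨ l = 17 ∨ l = 19)
    (T : Cor22.ThetaVolumeDatumAt (ratPoint (((2 : ℕ) : ℚ) / (23 ^ 5 : ℕ))) l) (u : FinitePlace ℚ) (hu : ratChar u = 23) :
    letI := T.instFieldF; letI := T.instNumberFieldF; letI := T.instAlgebraF; letI := T.instFieldK
    letI := T.instNumberFieldK; letI := T.instAlgebraK; letI := T.instFieldFbar; letI := T.instAlgebraFbar
    letI := T.instAlgebraKFbar; letI := T.instIsElliptic
    ∀ (M : Type) [Field M] [NumberField M]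
      (archPk : ∀ (j : (thetaIndexOfInitial T.D).Label) (vQ : (thetaIndexOfInitial T.D).VQ),
        Set ((logShellsOfInitialDH T.D (analyticLogvVal T.K)).Packet j vQ))
      (archSub : ∀ (j : (thetaIndexOfInitial T.D).Label) (v : (thetaIndexOfInitial T.D).V),
        Set ((logShellsOfInitialDH T.D (analyticLogvVal T.K)).Packet j ((thetaIndexOfInitial T.D).over v)))
      (Ψ : ℤ → ∀ v : (thetaIndexOfInitial T.D).V, v ∈ (thetaIndexOfInitial T.D).Vbad →
        Set ((logShellsOfInitialDH T.D (analyticLogvVal T.K)).StarPacket v))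
      (act : ℤ → ∀ v : (thetaIndexOfInitial T.D).V, v ∈ (thetaIndexOfInitial T.D).Vbad →
        (logShellsOfInitialDH T.D (analyticLogvVal T.K)).StarPacket v →
          Module.End ℚ ((logShellsOfInitialDH T.D (analyticLogvVal T.K)).StarPacket v))
      (Mmod : ℤ → ∀ j : (thetaIndexOfInitial T.D).LabelStar, Set ((logShellsOfInitialDH T.D (analyticLogvVal T.K)).GlobalPacket j.1))
      (region : ℤ → ∀ j : (thetaIndexOfInitial T.D).LabelStar, FinDivisor M → ∀ vQ : (thetaIndexOfInitial T.D).VQ,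
        Set ((logShellsOfInitialDH T.D (analyticLogvVal T.K)).Packet j.1 vQ))
      (frobAdm : ℤ → ℤ → ∀ (j : (thetaIndexOfInitial T.D).Label) (vQ : (thetaIndexOfInitial T.D).VQ),
        Set ((logShellsOfInitialDH T.D (analyticLogvVal T.K)).Packet j vQ) → Prop)
      (frobLogvol : ℤ → ℤ → ∀ (j : (thetaIndexOfInitial T.D).Label) (vQ : (thetaIndexOfInitial T.D).VQ),
        Set ((logShellsOfInitialDH T.D (analyticLogvVal T.K)).Packet j vQ) → ℝ)
      (frobΨ : ℤ → ℤ → ∀ v : (thetaIndexOfInitial T.D).V, v ∈ (thetaIndexOfInitial T.D).Vbad →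
        Set ((logShellsOfInitialDH T.D (analyticLogvVal T.K)).StarPacket v))
      (frobMmod : ℤ → ℤ → ∀ j : (thetaIndexOfInitial T.D).LabelStar, Set ((logShellsOfInitialDH T.D (analyticLogvVal T.K)).GlobalPacket j.1))
      (unitImage : ℤ → ℤ → ℕ → ∀ (j : (thetaIndexOfInitial T.D).Label) (vQ : (thetaIndexOfInitial T.D).VQ),
        Set ((logShellsOfInitialDH T.D (analyticLogvVal T.K)).Packet j vQ))
      (ballImage : ℤ → ℤ → ∀ (j : (thetaIndexOfInitial T.D).Label) (vQ : (thetaIndexOfInitial T.D).VQ),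
        Set ((logShellsOfInitialDH T.D (analyticLogvVal T.K)).Packet j vQ))
      (thetaDiv : ℤ → ℤ → LgpDivisor M (thetaIndexOfInitial T.D).lstar)
      (n : ℤ) {HT : Type} {LogLink : HT → HT → Type} {IsFull : ∀ {s t : HT}, LogLink s t → Prop}
      (lat : LGPGaussianLogThetaLattice LogLink IsFull)
      {Frd : Type} {IsoF : Frd → Frd → Type} {Ob : Frd → Type} {realify : Frd → Frd} {Strip : Type}
      {IsoS : Strip → Strip → Type} {Mv : ∀ v : (thetaIndexOfInitial T.D).V, v ∈ (thetaIndexOfInitial T.D).Vbad → Type}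
      [∀ v h, Monoid (Mv v h)]
      (sig : GlobalLGPFrobenioidSignature (thetaIndexOfInitial T.D).lstar (thetaIndexOfInitial T.D).V
        (· ∈ (thetaIndexOfInitial T.D).Vbad) Frd IsoF Ob realify Strip IsoS Mv)
      (split : SplittingMonoids Mv) {ObΔ : Type} {N : ∀ v : (thetaIndexOfInitial T.D).V, v ∈ (thetaIndexOfInitial T.D).Vbad → Type}
      [∀ v h, Monoid (N v h)] (qData : QPilotData ObΔ N)
      (qK : ∀ v : (thetaIndexOfInitial T.D).V, v ∈ (thetaIndexOfInitial T.D).Vbad →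
        Set ((logShellsOfInitialDH T.D (analyticLogvVal T.K)).StarPacket v)),
      ¬ Cor312Vol.PilotKummerCompatHull
        (LatticeSituation.ofShells (logShellsOfInitialDH T.D (analyticLogvVal T.K)) M archPk archSub
          (summandPiecesPrM T.D (logvAnalyticVal_analyticLogvVal (K := T.K))).Adm (summandPiecesPrM T.D (logvAnalyticVal_analyticLogvVal (K := T.K))).logvol Ψ act Mmod region frobAdm frobLogvol
          frobΨ frobMmod unitImage ballImage thetaDiv)
        (settingPrVolSharpM T.D (logvAnalyticVal_analyticLogvVal (K := T.K)) (tOfIdeleData T.D (ideleDataOf T.D T.isVolumeInputOf))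
          (fun u x => tqM T.D (ratChar u) u (natCast_ratChar_mem u) (ideleDataOf T.D T.isVolumeInputOf) x) M archPk archSub Ψ act Mmod region n lat sig split qData
          (fun u x => tqM_ne_zero T.D (ratChar u) u (natCast_ratChar_mem u) (ideleDataOf T.D T.isVolumeInputOf) x)
          (GenuineM.finite_ratPlaces_under_S T.D).toFinset
          (fun u x hu => norm_tqM_eq_one_of_not_mem T.D (ratChar u) u (natCast_ratChar_mem u) (ideleDataOf T.D T.isVolumeInputOf) x
            fun hx => hu ((Set.Finite.mem_toFinset _).mpr ⟨x, hx⟩)))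
        (fun _ => Cor312.Setting.qRegion
          (settingPrVolSharpM T.D (logvAnalyticVal_analyticLogvVal (K := T.K)) (tOfIdeleData T.D (ideleDataOf T.D T.isVolumeInputOf))
          (fun u x => tqM T.D (ratChar u) u (natCast_ratChar_mem u) (ideleDataOf T.D T.isVolumeInputOf) x) M archPk archSub Ψ act Mmod region n lat sig split qData
          (fun u x => tqM_ne_zero T.D (ratChar u) u (natCast_ratChar_mem u) (ideleDataOf T.D T.isVolumeInputOf) x)
          (GenuineM.finite_ratPlaces_under_S T.D).toFinset
          (fun u x hu => norm_tqM_eq_one_of_not_mem T.D (ratChar u) u (natCast_ratChar_mem u) (ideleDataOf T.D T.isVolumeInputOf) x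
            fun hx => hu ((Set.Finite.mem_toFinset _).mpr ⟨x, hx⟩)))) qK := by
  rcases hl with rfl | rfl | rfl
  · -- `l = 13`: `p = 23`, `v = 5`, label `j = 6`, local type `e ∣ 6 * 13`
    exact GenuineM.not_pilotKummerCompatHull_triple_of_radCerts (b := 3 ^ 10 * 109) Literature.Barriers.ABC.reyssat_isABCTriple T u 23 hu (by norm_num)
      (by norm_num) 5 (by norm_num) (by norm_num) (by norm_num) 5 (by norm_num) (6 * 13) (by norm_num)
      (GenuineM.absRamificationIdx_kOfM_dvd_of_triple_six (b := 3 ^ 10 * 109) (v := 5) Literature.Barriers.ABC.reyssat_isABCTriple T u 23 hu (by norm_num) (by norm_num)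
        (by norm_num) (by norm_num) (by norm_num) (by norm_num) (by norm_num) (by norm_num : 5 ∣ 5))
      [(1, 1, 0, 6), (2, 1, 0, 7), (3, 1, 0, 7), (6, 1, 0, 7), (13, 1, 0, 7), (26, 2, 1, 7), (39, 2, 1, 7), (78, 4, 1, 7)]
      (RadRow.cover_of_prime (D := 6) (l := 13) (by norm_num) (by norm_num) _ (by decide) (by decide)) (by decide)
  · -- `l = 17`: `p = 23`, `v = 5`, label `j = 8`, local type `e ∣ 6 * 17`
    exact GenuineM.not_pilotKummerCompatHull_triple_of_radCerts (b := 3 ^ 10 * 109) Literature.Barriers.ABC.reyssat_isABCTriple T u 23 hu (by norm_num)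
      (by norm_num) 5 (by norm_num) (by norm_num) (by norm_num) 7 (by norm_num) (6 * 17) (by norm_num)
      (GenuineM.absRamificationIdx_kOfM_dvd_of_triple_six (b := 3 ^ 10 * 109) (v := 5) Literature.Barriers.ABC.reyssat_isABCTriple T u 23 hu (by norm_num) (by norm_num)
        (by norm_num) (by norm_num) (by norm_num) (by norm_num) (by norm_num) (by norm_num : 5 ∣ 5))
      [(1, 1, 0, 9), (2, 1, 0, 10), (3, 1, 0, 10), (6, 1, 0, 10), (17, 1, 0, 10), (34, 2, 1, 10), (51, 3, 1, 10), (102, 5, 1, 10)]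
      (RadRow.cover_of_prime (D := 6) (l := 17) (by norm_num) (by norm_num) _ (by decide) (by decide)) (by decide)
  · -- `l = 19`: `p = 23`, `v = 5`, label `j = 9`, local type `e ∣ 6 * 19`
    exact GenuineM.not_pilotKummerCompatHull_triple_of_radCerts (b := 3 ^ 10 * 109) Literature.Barriers.ABC.reyssat_isABCTriple T u 23 hu (by norm_num)
      (by norm_num) 5 (by norm_num) (by norm_num) (by norm_num) 8 (by norm_num) (6 * 19) (by norm_num)
      (GenuineM.absRamificationIdx_kOfM_dvd_of_triple_six (b := 3 ^ 10 * 109) (v := 5) Literature.Barriers.ABC.reyssat_isABCTriple T u 23 hu (by norm_num) (by norm_num)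
        (by norm_num) (by norm_num) (by norm_num) (by norm_num) (by norm_num) (by norm_num : 5 ∣ 5))
      [(1, 1, 0, 11), (2, 1, 0, 11), (3, 1, 0, 11), (6, 1, 0, 12), (19, 1, 0, 12), (38, 2, 1, 12), (57, 3, 1, 11), (114, 6, 1, 11)]
      (RadRow.cover_of_prime (D := 6) (l := 19) (by norm_num) (by norm_num) _ (by decide) (by decide)) (by decide)

end Summit.ABC.IUTFork.Conditional

end
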